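import Literature.NumberTheory.Automorphic.SiegelReducedFamilies
import Mathlib.Topology.Instances.Matrix
import Mathlib.Analysis.Complex.Basic
import HarnessLib

/-!
# Reducedness of Siegel families is relatively open (stub `stub_hull_relOpen` of line `Sketch`)

Crux `HeckeEigenvalueField` (stmt-Langlands-13632).  The Čech-nerve proof of the Borel–Serre
finite-dimensionality theorem covers the cone of positive forms by translates of convex hulls of
Siegel domains; the prototype of the cover has to be open in the (closed) subspace of self-adjoint
families.  Siegel domains are described recursively by the predicate
`SiegelFamily.IsReduced c C τ m H` on families `H : ι → Matrix (Fin m) (Fin m) ℂ`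
(`Literature/NumberTheory/Automorphic/SiegelReducedFamilies`): every `H w` is Hermitian, the last
pivots `H w m m` are positive, pairwise comparable, dominate the last column and are dominated by
the next Schur pivot, and the family of Schur complements `SiegelFamily.schur H` is reduced.

This file proves the registered stub `stub_hull_relOpen`: for a finite index type `ι` there is an
OPEN set `O` of families with
`{H | IsReduced c C τ m H} = {H | ∀ w, (H w).IsHermitian} ∩ O`.
The proof is the obvious induction on `m`: the Hermitian clause is closed and is split off; all
the other clauses are strict inequalities between continuous functions of the entries, the Schur
complement is continuous on the open set `U` of families with non-zero last pivots (so we work on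
the subtype `U` and push the open set forward along the open embedding `U → _`), and the Schur
complement of a Hermitian matrix is again Hermitian, so that the inductive Hermitian clause is
automatic on Hermitian families.

## References

* A. Borel, *Introduction aux groupes arithmétiques*, Hermann (1969), §1, §12–§13 [Borel1969]
  (Siegel sets on positive forms are open).
-/

noncomputable section

set_option linter.dupNamespace false -- project-wide: `Summit.Langlands.Langlands` is the mandated namespace

open scoped ComplexOrder Matrix
open Literature.NumberTheory.Automorphic

namespace Summit.Langlands.Langlands.Theorems.HeckeEigenvalueField.Res

/-! ### Small topological helpers -/

/-- An implication with constant premise defines an open set as soon as its conclusion does.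
[folklore] -/
private theorem relOpen_isOpen_setOf_imp {X : Type*} [TopologicalSpace X] (p : Prop)
    {q : X → Prop} (hq : IsOpen {x | q x}) : IsOpen {x | p → q x} := by
  by_cases hp : p
  · simpa [hp] using hq
  · simp [hp]

/-- A universally quantified condition over a finite type defines an open set as soon as each
instance does (finite intersection of open sets). [folklore] -/
private theorem relOpen_isOpen_setOf_forall {X κ : Type*} [TopologicalSpace X] [Finite κ]
    {p : κ → X → Prop} (h : ∀ k, IsOpen {x | p k x}) : IsOpen {x | ∀ k, p k x} := by
  rw [Set.setOf_forall]
  exact isOpen_iInter_of_finite h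

/-- The entries of a family of matrices depend continuously on the family. [folklore] -/
private theorem relOpen_continuous_entry {ι : Type*} {n : ℕ} (w : ι) (i j : Fin n) :
    Continuous fun H : ι → Matrix (Fin n) (Fin n) ℂ => H w i j :=
  (continuous_apply w).matrix_elem i j

/-! ### The Schur complement of a Hermitian family is Hermitian -/

/-- The Schur complement (of the last pivot) of a Hermitian matrix is Hermitian: its entries are
`H i j - H i m * H m j / H m m` with `H m m` real. [folklore] -/
private theorem relOpen_schur_isHermitian {ι : Type*} {m : ℕ}
    (H : ι → Matrix (Fin (m + 1)) (Fin (m + 1)) ℂ) (w : ι) (h : (H w).IsHermitian) :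
    (SiegelFamily.schur H w).IsHermitian := by
  refine Matrix.IsHermitian.ext fun i j => ?_
  simp only [SiegelFamily.schur_apply, star_sub, star_div₀, star_mul', h.apply]
  rw [mul_comm]

/-! ### The inductive step -/

/-- **Inductive step**: if reducedness in size `m` is relatively open (witnessed by the open set
`Om`), then so is reducedness in size `m + 1`.  The witness is the image, under the open embedding
of the open set `U` of families with non-zero last pivots, of the subset of `U` cut out by the
strict inequalities of `isReduced_succ_iff` and by `schur ⁻¹' Om`; on `U` the Schur complement is
continuous. [folklore] -/
private theorem relOpen_succ {ι : Type*} [Finite ι] {m : ℕ} (c C τ : ℝ)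
    {Om : Set (ι → Matrix (Fin m) (Fin m) ℂ)} (hOm : IsOpen Om)
    (hEq : {G | SiegelFamily.IsReduced c C τ m G} = {G | ∀ w, (G w).IsHermitian} ∩ Om) :
    ∃ O : Set (ι → Matrix (Fin (m + 1)) (Fin (m + 1)) ℂ), IsOpen O ∧
      {H | SiegelFamily.IsReduced c C τ (m + 1) H} = {H | ∀ w, (H w).IsHermitian} ∩ O := by
  -- reducedness of the Schur complement, through the induction hypothesis
  have key : ∀ G : ι → Matrix (Fin (m + 1)) (Fin (m + 1)) ℂ,
      SiegelFamily.IsReduced c C τ m (SiegelFamily.schur G) ↔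
        (∀ w, (SiegelFamily.schur G w).IsHermitian) ∧ SiegelFamily.schur G ∈ Om := fun G => by
    have hG := Set.ext_iff.mp hEq (SiegelFamily.schur G)
    simpa only [Set.mem_setOf_eq, Set.mem_inter_iff] using hG
  -- the open set of families with non-zero last pivots
  set U : Set (ι → Matrix (Fin (m + 1)) (Fin (m + 1)) ℂ) :=
    {H | ∀ w, H w (Fin.last m) (Fin.last m) ≠ 0} with hU_def
  have hU : IsOpen U :=
    relOpen_isOpen_setOf_forall fun w =>
      isOpen_ne_fun (relOpen_continuous_entry w _ _) continuous_const
  -- entries and Schur complements are continuous on `U`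
  have hE : ∀ (w : ι) (i j : Fin (m + 1)),
      Continuous fun x : U => (x : ι → Matrix (Fin (m + 1)) (Fin (m + 1)) ℂ) w i j :=
    fun w i j => (relOpen_continuous_entry w i j).comp continuous_subtype_val
  have hS : Continuous fun x : U =>
      SiegelFamily.schur (x : ι → Matrix (Fin (m + 1)) (Fin (m + 1)) ℂ) := by
    refine continuous_pi fun w => continuous_matrix fun i j => ?_
    simp only [SiegelFamily.schur_apply]
    exact (hE w _ _).sub (((hE w _ _).mul (hE w _ _)).div₀ (hE w _ _) fun x => x.2 w)
  have hre : ∀ (w : ι) (i j : Fin (m + 1)),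
      Continuous fun x : U => ((x : ι → Matrix (Fin (m + 1)) (Fin (m + 1)) ℂ) w i j).re :=
    fun w i j => Complex.continuous_re.comp (hE w i j)
  -- the open subset of `U` cut out by the strict inequalities and the induction hypothesis
  set V : Set U := {x |
      ((∀ w, 0 < ((x : ι → Matrix (Fin (m + 1)) (Fin (m + 1)) ℂ) w (Fin.last m) (Fin.last m)).re) ∧
        (∀ w w', ((x : ι → Matrix (Fin (m + 1)) (Fin (m + 1)) ℂ) w (Fin.last m) (Fin.last m)).re <
          C * ((x : ι → Matrix (Fin (m + 1)) (Fin (m + 1)) ℂ) w' (Fin.last m) (Fin.last m)).re) ∧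
        (∀ w (j : Fin m),
          ‖(x : ι → Matrix (Fin (m + 1)) (Fin (m + 1)) ℂ) w j.castSucc (Fin.last m)‖ <
            c * ((x : ι → Matrix (Fin (m + 1)) (Fin (m + 1)) ℂ) w (Fin.last m) (Fin.last m)).re) ∧
        (∀ w (j : Fin m), (j : ℕ) + 1 = m →
          ((x : ι → Matrix (Fin (m + 1)) (Fin (m + 1)) ℂ) w (Fin.last m) (Fin.last m)).re <
            τ * (SiegelFamily.schur (x : ι → Matrix (Fin (m + 1)) (Fin (m + 1)) ℂ) w j j).re)) ∧
      SiegelFamily.schur (x : ι → Matrix (Fin (m + 1)) (Fin (m + 1)) ℂ) ∈ Om} with hV_def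
  have hV : IsOpen V := by
    refine IsOpen.and (IsOpen.and ?_ (IsOpen.and ?_ (IsOpen.and ?_ ?_))) (hOm.preimage hS)
    · exact relOpen_isOpen_setOf_forall fun w => isOpen_lt continuous_const (hre w _ _)
    · exact relOpen_isOpen_setOf_forall fun w => relOpen_isOpen_setOf_forall fun w' =>
        isOpen_lt (hre w _ _) (continuous_const.mul (hre w' _ _))
    · exact relOpen_isOpen_setOf_forall fun w => relOpen_isOpen_setOf_forall fun j =>
        isOpen_lt (hE w _ _).norm (continuous_const.mul (hre w _ _))
    · exact relOpen_isOpen_setOf_forall fun w => relOpen_isOpen_setOf_forall fun j =>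
        relOpen_isOpen_setOf_imp _ (isOpen_lt (hre w _ _) (continuous_const.mul
          (Complex.continuous_re.comp (((continuous_apply w).comp hS).matrix_elem j j))))
  refine ⟨Subtype.val '' V, hU.isOpenMap_subtype_val V hV, Set.ext fun H => ?_⟩
  simp only [Set.mem_setOf_eq, Set.mem_inter_iff, SiegelFamily.isReduced_succ_iff]
  constructor
  · rintro ⟨hh, hpos, hcross, hcol, hratio, hsch⟩
    have hHU : H ∈ U := fun w h0 => absurd (hpos w) (by rw [h0, Complex.zero_re]; exact lt_irrefl 0)
    have hHV : (⟨H, hHU⟩ : U) ∈ V := ⟨⟨hpos, hcross, hcol, hratio⟩, ((key H).mp hsch).2⟩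
    exact ⟨hh, Set.mem_image_of_mem Subtype.val hHV⟩
  · rintro ⟨hh, ⟨H', hHU⟩, ⟨⟨hpos, hcross, hcol, hratio⟩, hS'⟩, rfl⟩
    exact ⟨hh, hpos, hcross, hcol, hratio,
      (key H').mpr ⟨fun w => relOpen_schur_isHermitian H' w (hh w), hS'⟩⟩

/-! ### The registered stub -/

/-- **Stub HULL-RELOPEN — reducedness is an open condition on Hermitian families**: for a finite
index set, `{H | IsReduced c C τ m H} = {H | ∀ w, (H w).IsHermitian} ∩ O` for an OPEN set `O` of
families (strict inequalities of continuous functions of the entries; the Schur complement is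
continuous where the pivot is non-zero; induction on `m`). [folklore] -/
theorem stub_hull_relOpen :
    ∀ (ι : Type) [Finite ι] (m : ℕ) (c C τ : ℝ), ∃ O : Set (ι → Matrix (Fin m) (Fin m) ℂ),
      IsOpen O ∧ {H | SiegelFamily.IsReduced c C τ m H} = {H | ∀ w, (H w).IsHermitian} ∩ O := by
  intro ι _ m c C τ
  induction m with
  | zero =>
    refine ⟨Set.univ, isOpen_univ, Set.ext fun H => ?_⟩
    simp only [Set.mem_setOf_eq, Set.inter_univ, SiegelFamily.isReduced_zero, true_iff]
    exact fun w => Matrix.IsHermitian.ext fun i => Fin.elim0 i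
  | succ m ih =>
    obtain ⟨Om, hOm, hEq⟩ := ih
    exact relOpen_succ c C τ hOm hEq

end Summit.Langlands.Langlands.Theorems.HeckeEigenvalueField.Res
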